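/-
Copyright (c) 2026. All rights reserved.
Released under Apache 2.0 license as described in the file LICENSE.
-/
import Literature.NumberTheory.Waring.ThreeSquaresCount
import HarnessLib

/-!
# The number of representations as a sum of three triangular numbers: `δ₃(n) = r₃(8n+3)/8 = 3·H(8n+3)`

`δ₃(n) = #{(a, b, c) ∈ ℕ³ : T_a + T_b + T_c = n}`, `T_a = a(a+1)/2` (ordered triples). Ono–Robins–Wahl's
Proposition 2 («`δ_k(n) = q_k(8n + k)`», `q_k` the representations by `k` odd squares, through `n = Σ T_{xᵢ} ⟺
8n + k = Σ (2xᵢ + 1)²`) and their §3 («if `α² + β² + γ² ≡ 3 (mod 8)` then `α, β, γ` are all odd. Consequently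
`δ₃(n) = q₃(8n+3) = ⅛ r₃(8n+3)`; the scalar `⅛` compensates for the 8 choices of sign») give, with Gauss's count
`r₃(8n+3) = 24·H(8n+3)` of the tree (`Waring/ThreeSquaresCount`),

  `δ₃(n) = 3·H(8n + 3) > 0`

— Gauss's ΕΥΡΗΚΑ theorem («every non-negative integer is represented as a sum of three triangular numbers. In our
notation this says that if `n ≥ 0`, then `δ₃(n) > 0`») with the exact count.

* §1 (private arithmetic: `Σ (2xᵢ+1)² = 8n+3 ⟺ Σ T_{xᵢ} = n`, signs and halves of odd integers);
  **`card_sphere_eq_eight_mul_card_triangular`** (`r₃(8n+3) = 8·δ₃(n)`: an explicit equivalence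
  `{y ∈ ℤ³ : Σ yᵢ² = 8n+3} ≃ {x ∈ ℕ³ : Σ T_{xᵢ} = n} × {±1}³`, `y ↦ ((|yᵢ| − 1)/2)ᵢ, (sgn yᵢ)ᵢ`).
* §2 **`card_triangular_eq`** (`δ₃(n) = 3·H(8n+3)`), **`card_triangular_pos`** (`δ₃(n) > 0`, from `H(8n+3) > 0`),
  values `card_triangular_zero` (`δ₃(0) = 1`), `card_triangular_one` (`δ₃(1) = 3`).

## Sources

* K. Ono, S. Robins, P. T. Wahl, *On the representation of integers as sums of triangular numbers*, Aequationes
  Math. 50 (1995) 73–94, §2 Prop. 2 (`δ_k(n) = q_k(8n+k)`) and §3, the case `k = 3` (`δ₃(n) = q₃(8n+3) =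
  ⅛ r₃(8n+3)`), §1 (Gauss's Eureka theorem: `δ₃(n) > 0`). [cite: OnoRobinsWahl1995, §2 Prop. 2; §3 (k = 3); §1]
* C. F. Gauss, *Disquisitiones Arithmeticae* (1801), Art. 293 (ΕΥΡΗΚΑ: `num = Δ + Δ + Δ`). [cite: Gauss1801, Art. 293]
* E. T. Mortenson, Bull. LMS 49 (2017), Thm. 4 (`r₃(n) = 24H(n)` for `n ≡ 3 (mod 8)`). [cite: Mortenson2017, Thm. 4]

## Scope (honest)

Theorems only — no definition, no named fact, no instance; the equivalence is built inside the proof. Triples are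
ordered and range over `ℕ³` (Ono–Robins–Wahl's `δ₃`); `T_a` is spelled `a * (a + 1) / 2` as in the tree's
`exists_triangular_add_triangular_add_triangular`.
-/

open Literature.NumberTheory.QuadraticFields

namespace Literature.NumberTheory.Waring.ThreeTriangularNumbersCount

/-! ## §1 `r₃(8n + 3) = 8·δ₃(n)` -/

section Bijection

/-- `Σ uᵢ² = 8n + 3` in `ℕ` forces all `uᵢ` odd and `Σ T_{(uᵢ−1)/2} = n`. [folklore] -/
private theorem tri_of_sq {u v w n : ℕ} (h : u ^ 2 + v ^ 2 + w ^ 2 = 8 * n + 3) :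
    u / 2 * (u / 2 + 1) / 2 + v / 2 * (v / 2 + 1) / 2 + w / 2 * (w / 2 + 1) / 2 = n := by
  obtain ⟨⟨p, rfl⟩, ⟨q, rfl⟩, ⟨r, rfl⟩⟩ := odd_of_sq_add_sq_add_sq_eq h
  have e1 : (2 * p + 1) / 2 = p := by omega
  have e2 : (2 * q + 1) / 2 = q := by omega
  have e3 : (2 * r + 1) / 2 = r := by omega
  rw [e1, e2, e3]
  have key : p * (p + 1) + q * (q + 1) + r * (r + 1) = 2 * n := by nlinarith [h]
  obtain ⟨kp, hkp⟩ := Nat.even_mul_succ_self p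
  obtain ⟨kq, hkq⟩ := Nat.even_mul_succ_self q
  obtain ⟨kr, hkr⟩ := Nat.even_mul_succ_self r
  generalize p * (p + 1) = P at hkp key ⊢
  generalize q * (q + 1) = Q at hkq key ⊢
  generalize r * (r + 1) = R at hkr key ⊢
  omega

/-- `Σ T_{xᵢ} = n` gives `Σ (2xᵢ + 1)² = 8n + 3`. [folklore] -/
private theorem sq_of_tri {p q r n : ℕ} (h : p * (p + 1) / 2 + q * (q + 1) / 2 + r * (r + 1) / 2 = n) :
    (2 * p + 1) ^ 2 + (2 * q + 1) ^ 2 + (2 * r + 1) ^ 2 = 8 * n + 3 := by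
  obtain ⟨kp, hkp⟩ := Nat.even_mul_succ_self p
  obtain ⟨kq, hkq⟩ := Nat.even_mul_succ_self q
  obtain ⟨kr, hkr⟩ := Nat.even_mul_succ_self r
  have key : p * (p + 1) + q * (q + 1) + r * (r + 1) = 2 * n := by
    have hp' := hkp; have hq' := hkq; have hr' := hkr
    generalize p * (p + 1) = P at hp' h ⊢
    generalize q * (q + 1) = Q at hq' h ⊢
    generalize r * (r + 1) = R at hr' h ⊢
    omega
  nlinarith [key]

/-- `(±z)² = z²` for the sign switch `bif b then −z else z`. [folklore] -/
private theorem sq_bif_neg (b : Bool) (z : ℤ) : (bif b then -z else z) ^ 2 = z ^ 2 := by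
  cases b <;> simp

/-- `|±m| = m`. [folklore] -/
private theorem natAbs_bif_neg (b : Bool) (m : ℕ) : (bif b then -(m : ℤ) else (m : ℤ)).natAbs = m := by
  cases b <;> simp

/-- The sign of `±(2p + 1)` is `b`. [folklore] -/
private theorem decide_bif_neg (b : Bool) (p : ℕ) :
    decide ((bif b then -(((2 * p + 1 : ℕ)) : ℤ) else ((2 * p + 1 : ℕ) : ℤ)) < 0) = b := by
  cases b
  · simp only [cond_false, decide_eq_false_iff_not, not_lt]
    positivity
  · simp only [cond_true, decide_eq_true_eq, Left.neg_neg_iff]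
    positivity

/-- An odd integer is `± (2·(|z|/2) + 1)` with the sign read off `z < 0`. [folklore] -/
private theorem bif_decide_eq (z : ℤ) (hz : z.natAbs % 2 = 1) :
    (bif decide (z < 0) then -(((2 * (z.natAbs / 2) + 1 : ℕ)) : ℤ) else ((2 * (z.natAbs / 2) + 1 : ℕ) : ℤ)) = z := by
  by_cases h : z < 0
  · rw [decide_eq_true h, cond_true]
    omega
  · rw [decide_eq_false h, cond_false]
    omega

/-- **`r₃(8n + 3) = 8·δ₃(n)`** (Ono–Robins–Wahl Prop. 2 and §3: «`δ₃(n) = q₃(8n+3) = ⅛ r₃(8n+3)` … the scalar `⅛`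
compensates for the 8 choices of sign»): the explicit equivalence `{y ∈ ℤ³ : Σ yᵢ² = 8n+3} ≃
{x ∈ ℕ³ : Σ T_{xᵢ} = n} × Bool³`, `y ↦ (((|yᵢ| − 1)/2)ᵢ, (yᵢ < 0)ᵢ)`, all `yᵢ` being odd.
[cite: OnoRobinsWahl1995, §2 Prop. 2 and §3 (k = 3)] -/
theorem card_sphere_eq_eight_mul_card_triangular (n : ℕ) :
    Nat.card {y : ℤ × ℤ × ℤ // y.1 ^ 2 + y.2.1 ^ 2 + y.2.2 ^ 2 = ((8 * n + 3 : ℕ) : ℤ)} = 8 * Nat.card {x : ℕ × ℕ × ℕ // x.1 * (x.1 + 1) / 2 + x.2.1 * (x.2.1 + 1) / 2 + x.2.2 * (x.2.2 + 1) / 2 = n} := by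
  have habs : ∀ y : {y : ℤ × ℤ × ℤ // y.1 ^ 2 + y.2.1 ^ 2 + y.2.2 ^ 2 = ((8 * n + 3 : ℕ) : ℤ)},
      y.1.1.natAbs ^ 2 + y.1.2.1.natAbs ^ 2 + y.1.2.2.natAbs ^ 2 = 8 * n + 3 := by
    rintro ⟨⟨a, b, c⟩, h⟩
    apply Nat.cast_injective (R := ℤ)
    rw [Nat.cast_add, Nat.cast_add, Nat.cast_pow, Nat.cast_pow, Nat.cast_pow, Int.natAbs_sq, Int.natAbs_sq,
      Int.natAbs_sq]
    exact h
  have hodd : ∀ y : {y : ℤ × ℤ × ℤ // y.1 ^ 2 + y.2.1 ^ 2 + y.2.2 ^ 2 = ((8 * n + 3 : ℕ) : ℤ)},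
      y.1.1.natAbs % 2 = 1 ∧ y.1.2.1.natAbs % 2 = 1 ∧ y.1.2.2.natAbs % 2 = 1 := fun y =>
    let ho := odd_of_sq_add_sq_add_sq_eq (habs y)
    ⟨Nat.odd_iff.1 ho.1, Nat.odd_iff.1 ho.2.1, Nat.odd_iff.1 ho.2.2⟩
  let e : {y : ℤ × ℤ × ℤ // y.1 ^ 2 + y.2.1 ^ 2 + y.2.2 ^ 2 = ((8 * n + 3 : ℕ) : ℤ)} ≃ {x : ℕ × ℕ × ℕ // x.1 * (x.1 + 1) / 2 + x.2.1 * (x.2.1 + 1) / 2 + x.2.2 * (x.2.2 + 1) / 2 = n} × (Bool × Bool × Bool) :=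
    { toFun := fun y =>
        (⟨(y.1.1.natAbs / 2, y.1.2.1.natAbs / 2, y.1.2.2.natAbs / 2), tri_of_sq (habs y)⟩,
          (decide (y.1.1 < 0), decide (y.1.2.1 < 0), decide (y.1.2.2 < 0)))
      invFun := fun x =>
        ⟨((bif x.2.1 then -(((2 * x.1.1.1 + 1 : ℕ)) : ℤ) else ((2 * x.1.1.1 + 1 : ℕ) : ℤ)),
            (bif x.2.2.1 then -(((2 * x.1.1.2.1 + 1 : ℕ)) : ℤ) else ((2 * x.1.1.2.1 + 1 : ℕ) : ℤ)),
            (bif x.2.2.2 then -(((2 * x.1.1.2.2 + 1 : ℕ)) : ℤ) else ((2 * x.1.1.2.2 + 1 : ℕ) : ℤ))), by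
          dsimp only
          rw [sq_bif_neg, sq_bif_neg, sq_bif_neg]
          exact_mod_cast sq_of_tri x.1.2⟩
      left_inv := by
        rintro ⟨⟨a, b, c⟩, h⟩
        obtain ⟨ha, hb, hc⟩ := hodd ⟨(a, b, c), h⟩
        dsimp only at ha hb hc
        apply Subtype.ext
        dsimp only
        rw [bif_decide_eq a ha, bif_decide_eq b hb, bif_decide_eq c hc]
      right_inv := by
        rintro ⟨⟨⟨p, q, r⟩, hx⟩, b₁, b₂, b₃⟩
        dsimp only
        have e1 : (2 * p + 1) / 2 = p := by omega
        have e2 : (2 * q + 1) / 2 = q := by omega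
        have e3 : (2 * r + 1) / 2 = r := by omega
        refine Prod.ext (Subtype.ext ?_) ?_
        · dsimp only
          rw [natAbs_bif_neg, natAbs_bif_neg, natAbs_bif_neg, e1, e2, e3]
        · rw [decide_bif_neg, decide_bif_neg, decide_bif_neg] }
  rw [Nat.card_congr e, Nat.card_prod, Nat.card_prod, Nat.card_prod, Nat.card_eq_fintype_card (α := Bool),
    Fintype.card_bool]
  ring

end Bijection

/-! ## §2 `δ₃(n) = 3·H(8n + 3) > 0` -/

section Count

/-- **`δ₃(n) = 3·H(8n + 3)`**: the number of ordered triples `(a, b, c) ∈ ℕ³` with `T_a + T_b + T_c = n` is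
`r₃(8n+3)/8 = 24H(8n+3)/8` (Ono–Robins–Wahl §3 with Gauss's `r₃(n) = 24H(n)`, `n ≡ 3 (mod 8)`, of the tree's
`ThreeSquaresCount.card_eq_of_mod_eight_eq_three`). [cite: OnoRobinsWahl1995, §3 (k = 3)] [cite: Mortenson2017, Thm. 4] -/
theorem card_triangular_eq (n : ℕ) : (Nat.card {x : ℕ × ℕ × ℕ // x.1 * (x.1 + 1) / 2 + x.2.1 * (x.2.1 + 1) / 2 + x.2.2 * (x.2.2 + 1) / 2 = n} : ℚ) = 3 * hurwitzClassNumber (8 * n + 3) := by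
  have h := ThreeSquaresCount.card_eq_of_mod_eight_eq_three (n := 8 * n + 3) (by omega)
  rw [card_sphere_eq_eight_mul_card_triangular] at h
  push_cast at h
  linarith

/-- **GAUSS'S ΕΥΡΗΚΑ THEOREM WITH THE COUNT: `δ₃(n) > 0`** («if `n ≥ 0`, then `δ₃(n) > 0`»), here from
`δ₃(n) = 3H(8n+3)` and `H(N) > 0` for `N ≡ 3 (mod 4)` (the tree's `hurwitzClassNumber_pos_iff`; the existence
statement alone is the tree's `exists_triangular_add_triangular_add_triangular`). [cite: OnoRobinsWahl1995, §1]
[cite: Gauss1801, Art. 293] -/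
theorem card_triangular_pos (n : ℕ) : 0 < Nat.card {x : ℕ × ℕ × ℕ // x.1 * (x.1 + 1) / 2 + x.2.1 * (x.2.1 + 1) / 2 + x.2.2 * (x.2.2 + 1) / 2 = n} := by
  have h := card_triangular_eq n
  have hH : 0 < hurwitzClassNumber (8 * n + 3) :=
    (hurwitzClassNumber_pos_iff (by positivity)).2 (Or.inr (by omega))
  have : (0 : ℚ) < Nat.card {x : ℕ × ℕ × ℕ // x.1 * (x.1 + 1) / 2 + x.2.1 * (x.2.1 + 1) / 2 + x.2.2 * (x.2.2 + 1) / 2 = n} := by rw [h]; positivity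
  exact_mod_cast this

/-- `δ₃(0) = 1 = 3·H(3)` (`0 = T₀ + T₀ + T₀`). [cite: OnoRobinsWahl1995, §1 (T₀ = 0)] -/
theorem card_triangular_zero : Nat.card {x : ℕ × ℕ × ℕ // x.1 * (x.1 + 1) / 2 + x.2.1 * (x.2.1 + 1) / 2 + x.2.2 * (x.2.2 + 1) / 2 = 0} = 1 := by
  have h := card_triangular_eq 0
  rw [Nat.cast_zero, mul_zero, zero_add, hurwitzClassNumber_three, show (3 : ℚ) * (1 / 3) = 1 by norm_num] at h
  exact_mod_cast h

/-- `δ₃(1) = 3 = 3·H(11)` (`1 = T₁ + T₀ + T₀` in three orders). [cite: OnoRobinsWahl1995, §1 (T₁ = 1)] -/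
theorem card_triangular_one : Nat.card {x : ℕ × ℕ × ℕ // x.1 * (x.1 + 1) / 2 + x.2.1 * (x.2.1 + 1) / 2 + x.2.2 * (x.2.2 + 1) / 2 = 1} = 3 := by
  have h := card_triangular_eq 1
  rw [Nat.cast_one, mul_one, show (8 : ℤ) + 3 = 11 by norm_num, hurwitzClassNumber_eleven, mul_one] at h
  exact_mod_cast h

end Count

end Literature.NumberTheory.Waring.ThreeTriangularNumbersCount
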